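import Summits.Schanuel.Schanuel.Theorems.RootDecomp1KGapCell07

/-!
# RootDecomp1KGapCell — lens 1, generation 42 «GAP CELL / INTERLACED SPECIALISATION» (lane K-R26 (α-loc)): the walls (1, ℓ_b, ρ), (1, ℓ₂, ℓ₃, ρ) (mod hNW), their π-twins and the 31077 pair (ℓ_b, ρ) HYPOTHESIS-FREE for every ρ ∈ `FactorialGapLiouville` — located order data strictly below the log-log floor; member ρ_W — continuation (RootDecomp1KGapCell08): §8 three interlaced scales: `form_lower_bound_G`, `not_hyperLinLiouville_zG3/zG3pi`, `item33364_at_zG3`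

(lens-1 g42 `GapCell.lean` EDITION 3 [HOME/decomp-schanuel-lens-1/g42/ sha256 6f7828b1…, 2470 l; VERDICT L2004, EDITIONS 2+3 L2018, ACK L2023]; port by census-1 gen 17 as
`RootDecomp1KGapCell01`–`10` — see the PORT NOTE of part 01; `--supports stmt-Schanuel-33364` (04: `stmt-Schanuel-31077`); rung 0.)
-/

open Summit.Schanuel.Schanuel.Theorems.RootDecomp1KHyper
open Summit.Schanuel.Schanuel.Theorems.RootDecomp1KHyper.HyperCell
open Summit.Schanuel.Schanuel.Theorems.RootDecomp1KRelLiouvilleCell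
open Summit.Schanuel.Schanuel.Theorems.RootDecomp1KLogLogCell
open Summit.Schanuel.Schanuel.Theorems.RootDecomp1KTwoBaseCell
open LiouvilleNumber
open scoped Nat

namespace Summit.Schanuel.Schanuel.Theorems.RootDecomp1KGapCell

variable {k n : ℕ}

/-- Upper bound for the tail in base `m ≥ 2`: `r_k ≤ 2·m^{-(k+1)!}` (tree twin: TwoBaseCell04 `remainder_le`). -/
private theorem remainder_le'' {m : ℝ} (hm : 2 ≤ m) (k : ℕ) : remainder m k ≤ 2 / m ^ (k + 1)! := by
  have m1 : (1 : ℝ) < m := by linarith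
  have h := remainder_lt' k m1
  have hhalf : (1 : ℝ) / m ≤ 1 / 2 := one_div_le_one_div_of_le two_pos hm
  have hpos : (0 : ℝ) < 1 - 1 / m := by linarith
  have hinv : (1 - 1 / m)⁻¹ ≤ 2 := by
    rw [inv_le_comm₀ hpos two_pos]
    linarith
  have hmk : (0 : ℝ) < 1 / m ^ (k + 1)! := by positivity
  calc remainder m k ≤ (1 - 1 / m)⁻¹ * (1 / m ^ (k + 1)!) := h.le
    _ ≤ 2 * (1 / m ^ (k + 1)!) := mul_le_mul_of_nonneg_right hinv hmk.le
    _ = 2 / m ^ (k + 1)! := by ring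

/-! ## §8  NO HYPER-SMALL FORMS IN `(1, ℓ₂, ρ_W)` — THREE INTERLACED SCALES (hypothesis-free); the member
`z_G' = (1, ℓ₂, ρ_W)` IS IN THE SCOPE OF ITEM 33364, and the item is DECIDED there -/

section ThreeScales

/-- `⌊√N⌋ + 2 ≤ N` for `N ≥ 3`. -/
private theorem sqrt_add_two_le {N : ℕ} (hN : 3 ≤ N) : Nat.sqrt N + 2 ≤ N := by
  obtain ⟨M, rfl⟩ : ∃ M, N = M + 1 := ⟨N - 1, by omega⟩
  have h : Nat.sqrt (M + 1) < M := Nat.sqrt_lt'.mpr (by nlinarith)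
  omega

/-- Interlacing, I: `c_N + N! ≤ (N+1)!` (`N ≥ 3`). -/
theorem cW_add_factorial_le {N : ℕ} (hN : 3 ≤ N) : cW N + N ! ≤ (N + 1)! := by
  unfold cW
  rw [Nat.factorial_succ]
  have := sqrt_add_two_le hN
  calc N ! * (Nat.sqrt N + 2) + N ! = (Nat.sqrt N + 3) * N ! := by ring
    _ ≤ (N + 1) * N ! := Nat.mul_le_mul_right _ (by omega)

/-- Interlacing, II: `(N+1)! + N! ≤ c_{N+1}`. -/
theorem factorial_add_le_cW_succ (N : ℕ) : (N + 1)! + N ! ≤ cW (N + 1) := by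
  have h := two_mul_factorial_le_cW (N + 1)
  have : N ! ≤ (N + 1)! := Nat.factorial_le (Nat.le_succ N)
  omega

/-- Approximation of the form by its truncation at cut `(K, M)`. -/
private theorem formG_approx (g : Fin 3 → ℤ) (K M : ℕ) :
    |((g 0 : ℝ) + g 1 * liouvilleNumber 2 + g 2 * rhoW) -
      ((g 0 : ℝ) + g 1 * partialSum 2 K + g 2 * tW M)| ≤
      |(g 1 : ℝ)| * (2 / 2 ^ (K + 1)!) + |(g 2 : ℝ)| * (2 / (2 : ℝ) ^ cW (M + 1)) := by
  have h2 := partialSum_add_remainder (by norm_num : (1 : ℝ) < 2) K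
  have hW := rhoW_eq_tW_add M
  have r2le : remainder 2 K ≤ 2 / 2 ^ (K + 1)! := remainder_le'' (by norm_num) K
  have r2pos := remainder_pos (by norm_num : (1 : ℝ) < 2) K
  have tle := tailW_le M
  have tpos := tailW_pos M
  have e : ((g 0 : ℝ) + g 1 * liouvilleNumber 2 + g 2 * rhoW) -
      ((g 0 : ℝ) + g 1 * partialSum 2 K + g 2 * tW M) =
      g 1 * remainder 2 K + g 2 * ∑' j, aW (j + (M + 1)) := by rw [← h2, hW]; ring
  rw [e]
  calc |(g 1 : ℝ) * remainder 2 K + g 2 * ∑' j, aW (j + (M + 1))|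
      ≤ |(g 1 : ℝ)| * remainder 2 K + |(g 2 : ℝ)| * ∑' j, aW (j + (M + 1)) := by
        refine (abs_add_le _ _).trans ?_
        rw [abs_mul, abs_mul, abs_of_pos r2pos, abs_of_pos tpos]
    _ ≤ |(g 1 : ℝ)| * (2 / 2 ^ (K + 1)!) + |(g 2 : ℝ)| * (2 / (2 : ℝ) ^ cW (M + 1)) := by gcongr

/-- Scale lower bound: a NON-ZERO truncation with cut `(K, M)` is `≥ 2^{−e}` whenever `K! ≤ e` and `c_M ≤ e`
(ONE radix: the common denominator is `2^e`). -/
private theorem formG_scale_lower (g : Fin 3 → ℤ) {K M e : ℕ} (hK : K ! ≤ e) (hM : cW M ≤ e)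
    (hne : (g 0 : ℝ) + g 1 * partialSum 2 K + g 2 * tW M ≠ 0) :
    1 / (2 : ℝ) ^ e ≤ |(g 0 : ℝ) + g 1 * partialSum 2 K + g 2 * tW M| := by
  have hp : partialSum 2 K = (psNumer 2 K : ℝ) / 2 ^ K ! := by
    have := partialSum_eq_psNumer_div (by norm_num : 0 < 2) K
    push_cast at this
    exact this
  set I : ℤ := g 0 * 2 ^ e + g 1 * (psNumer 2 K) * 2 ^ (e - K !) + g 2 * (MW M) * 2 ^ (e - cW M) with hI
  have hΦ : (g 0 : ℝ) + g 1 * partialSum 2 K + g 2 * tW M = (I : ℝ) / 2 ^ e := by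
    rw [hp, tW_eq, hI]
    push_cast
    rw [pow_sub₀ _ (two_ne_zero) hK, pow_sub₀ _ (two_ne_zero) hM]
    field_simp
  rw [hΦ] at hne ⊢
  have hI0 : I ≠ 0 := by
    intro h0; apply hne; rw [h0]; simp
  have hI1 : (1 : ℝ) ≤ |(I : ℝ)| := by exact_mod_cast Int.one_le_abs hI0
  rw [abs_div, abs_of_pos (by positivity : (0 : ℝ) < 2 ^ e)]
  exact div_le_div_of_nonneg_right hI1 (by positivity)

/-- **Three scales:** if the truncations at the cuts `(N, N)`, `(N+1, N)`, `(N+1, N+1)` all vanish then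
`g₁ = g₂ = 0` — the successive differences are `g₁ · 2^{−(N+1)!}` and `g₂ · 2^{−c_{N+1}}` (INTERLACED cuts: each
step adds ONE new term of ONE of the two series). -/
private theorem formG_three_scale (g : Fin 3 → ℤ) (N : ℕ)
    (h1 : (g 0 : ℝ) + g 1 * partialSum 2 N + g 2 * tW N = 0)
    (h2 : (g 0 : ℝ) + g 1 * partialSum 2 (N + 1) + g 2 * tW N = 0)
    (h3 : (g 0 : ℝ) + g 1 * partialSum 2 (N + 1) + g 2 * tW (N + 1) = 0) : g 1 = 0 ∧ g 2 = 0 := by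
  rw [partialSum_succ] at h2 h3
  have tS : tW (N + 1) = tW N + aW (N + 1) := by unfold tW; rw [Finset.sum_range_succ]
  rw [tS] at h3
  have d1 : (g 1 : ℝ) / 2 ^ (N + 1)! = 0 := by linear_combination h2 - h1
  have d2 : (g 2 : ℝ) * aW (N + 1) = 0 := by linear_combination h3 - h2
  constructor
  · have h : (g 1 : ℝ) = 0 := by
      rcases div_eq_zero_iff.mp d1 with h | h
      · exact h
      · exact absurd h (by positivity)
    exact_mod_cast h
  · have h : (g 2 : ℝ) = 0 := (mul_eq_zero.mp d2).resolve_right (aW_pos _).ne'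
    exact_mod_cast h

set_option maxHeartbeats 800000 in
/-- **THE THREE-SCALE FORM BOUND** (hypothesis-free): every non-zero integer form in `(1, ℓ₂, ρ_W)` satisfies
`exp(−(1+Σ|gᵢ|)^17) ≤ |g₀ + g₁ℓ₂ + g₂ρ_W|`.  (Scale `N ≥ 3` least with `8H ≤ 2^{N!}`; the interlacing
`N! < c_N < (N+1)! < c_{N+1} < (N+2)!` with all gaps `≥ N!` makes the truncation error at each of the three cuts at
most HALF the cut's resolution `2^{−c_N}`, `2^{−(N+1)!}`, `2^{−c_{N+1}}`; one of the three truncations is non-zero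
(`formG_three_scale`); and `c_{N+1} ≤ 4096 (1+H)^4` by minimality.) -/
theorem form_lower_bound_G (g : Fin 3 → ℤ) (hg : g ≠ 0) :
    Real.exp (-((1 + ∑ i, (|g i| : ℝ)) ^ 17)) ≤
      |(g 0 : ℝ) + g 1 * liouvilleNumber 2 + g 2 * rhoW| := by
  classical
  set HR : ℝ := ∑ i, (|g i| : ℝ) with hHR
  have hHR0 : 0 ≤ HR := by
    rw [hHR]; exact Finset.sum_nonneg fun i _ => by exact_mod_cast abs_nonneg (g i)
  have hexp1 : Real.exp (-((1 + HR) ^ 17)) ≤ 1 := by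
    rw [Real.exp_le_one_iff]
    have : (0 : ℝ) ≤ (1 + HR) ^ 17 := by positivity
    linarith
  by_cases h12 : g 1 = 0 ∧ g 2 = 0
  · -- `φ = g₀`, a non-zero integer
    have hg0 : g 0 ≠ 0 := by
      intro h0; apply hg; funext i
      fin_cases i <;> simp [h0, h12.1, h12.2]
    have h1 : (1 : ℝ) ≤ |(g 0 : ℝ) + g 1 * liouvilleNumber 2 + g 2 * rhoW| := by
      simp only [h12.1, h12.2, Int.cast_zero, zero_mul, add_zero]
      exact_mod_cast Int.one_le_abs hg0
    linarith
  · -- the natural height `Hn` and the scale `N = K₀ + 3`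
    set Hn : ℕ := ∑ i, (g i).natAbs with hHn
    have hHRn : HR = (Hn : ℝ) := by
      rw [hHR, hHn, Nat.cast_sum]
      refine Finset.sum_congr rfl fun i _ => ?_
      simp only [Nat.cast_natAbs, Int.cast_abs]
    have hHn1 : 1 ≤ Hn := by
      obtain ⟨i, hi⟩ := Function.ne_iff.mp hg
      have hi' : g i ≠ 0 := by simpa using hi
      have h1 : 1 ≤ (g i).natAbs := Int.natAbs_pos.mpr hi'
      exact h1.trans (Finset.single_le_sum (f := fun i => (g i).natAbs) (fun _ _ => Nat.zero_le _)
        (Finset.mem_univ i))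
    have hex : ∃ K : ℕ, 8 * Hn ≤ 2 ^ (K + 3)! := by
      refine ⟨8 * Hn, (Nat.lt_two_pow_self).le.trans (Nat.pow_le_pow_right (by norm_num) ?_)⟩
      exact (Nat.le_add_right _ _).trans (Nat.self_le_factorial _)
    set K₀ : ℕ := Nat.find hex with hK₀
    have hK₀spec : 8 * Hn ≤ 2 ^ (K₀ + 3)! := Nat.find_spec hex
    set N : ℕ := K₀ + 3 with hN
    have hN3 : 3 ≤ N := by omega
    have hHN : 8 * Hn ≤ 2 ^ N ! := hK₀spec
    -- `c_{N+1} ≤ 4096 (1+Hn)^4`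
    have hfac : (N + 1)! ≤ 512 * (1 + Hn) ^ 3 ∧ N + 3 ≤ 8 * (1 + Hn) := by
      rcases Nat.eq_zero_or_pos K₀ with hz | hpos
      · have h24 : (N + 1)! = 24 := by rw [hN, hz]; rfl
        have hN3' : N = 3 := by omega
        have h1 : 1 ≤ (1 + Hn) ^ 3 := Nat.one_le_pow _ _ (by omega)
        constructor <;> omega
      · have hmin := Nat.find_min hex (m := K₀ - 1) (by omega)
        rw [show K₀ - 1 + 3 = K₀ + 2 by omega] at hmin
        have hlt : (K₀ + 2)! < 8 * Hn := (Nat.lt_two_pow_self).trans (not_le.mp hmin)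
        have hK2 : K₀ + 2 ≤ (K₀ + 2)! := Nat.self_le_factorial _
        constructor
        · rw [hN, show K₀ + 3 + 1 = (K₀ + 2) + 1 + 1 by omega, Nat.factorial_succ, Nat.factorial_succ]
          have h1 : K₀ + 2 + 1 + 1 ≤ 8 * (1 + Hn) := by omega
          have h2 : K₀ + 2 + 1 ≤ 8 * (1 + Hn) := by omega
          have h3 : (K₀ + 2)! ≤ 8 * (1 + Hn) := by omega
          calc (K₀ + 2 + 1 + 1) * ((K₀ + 2 + 1) * (K₀ + 2)!)
              ≤ (8 * (1 + Hn)) * ((8 * (1 + Hn)) * (8 * (1 + Hn))) :=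
                Nat.mul_le_mul h1 (Nat.mul_le_mul h2 h3)
            _ = 512 * (1 + Hn) ^ 3 := by ring
        · omega
    have hcB : cW (N + 1) ≤ 4096 * (1 + Hn) ^ 4 := by
      obtain ⟨hf, hn3⟩ := hfac
      have hs : Nat.sqrt (N + 1) + 2 ≤ N + 3 := by have := Nat.sqrt_le_self (N + 1); omega
      unfold cW
      calc (N + 1)! * (Nat.sqrt (N + 1) + 2) ≤ (512 * (1 + Hn) ^ 3) * (8 * (1 + Hn)) :=
            Nat.mul_le_mul hf (hs.trans hn3)
        _ = 4096 * (1 + Hn) ^ 4 := by ring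
    have hcBR : ((cW (N + 1) : ℕ) : ℝ) ≤ 4096 * (1 + HR) ^ 4 := by
      rw [hHRn]; exact_mod_cast hcB
    -- the target in terms of the finest resolution `2^{−c_{N+1}}/2`
    have hgoal : Real.exp (-((1 + HR) ^ 17)) ≤ 1 / (2 : ℝ) ^ cW (N + 1) / 2 := by
      have hX2 : (2 : ℝ) ≤ 1 + HR := by
        rw [hHRn]; exact_mod_cast (show 2 ≤ 1 + Hn by omega)
      have hp13 : (8192 : ℝ) ≤ (1 + HR) ^ 13 := by
        calc (8192 : ℝ) = 2 ^ 13 := by norm_num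
          _ ≤ (1 + HR) ^ 13 := pow_le_pow_left₀ (by norm_num) hX2 13
      have h4 : (1 : ℝ) ≤ (1 + HR) ^ 4 := one_le_pow₀ (by linarith)
      have hE : ((cW (N + 1) : ℝ) + 1) ≤ (1 + HR) ^ 17 := by
        have h17 : (1 + HR) ^ 17 = (1 + HR) ^ 4 * (1 + HR) ^ 13 := by rw [← pow_add]
        rw [h17]
        nlinarith [hcBR, h4, hp13]
      have hlog2 : Real.log 2 ≤ 1 := by have := Real.log_two_lt_d9; linarith
      have hlog2pos : 0 < Real.log 2 := Real.log_pos (by norm_num)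
      have e1 : 1 / (2 : ℝ) ^ cW (N + 1) / 2 = Real.exp (-(((cW (N + 1) + 1 : ℕ) : ℝ) * Real.log 2)) := by
        rw [Real.exp_neg, Real.exp_nat_mul, Real.exp_log two_pos, pow_succ]
        field_simp
      rw [e1, Real.exp_le_exp, neg_le_neg_iff]
      push_cast
      calc ((cW (N + 1) : ℝ) + 1) * Real.log 2 ≤ ((cW (N + 1) : ℝ) + 1) * 1 :=
            mul_le_mul_of_nonneg_left hlog2 (by positivity)
        _ ≤ (1 + HR) ^ 17 := by rw [mul_one]; exact hE
    -- the truncation errors: at a cut whose error exponents exceed `e + N!` the error is `≤ 2^{−e}/2`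
    have hHsum : |(g 1 : ℝ)| + |(g 2 : ℝ)| ≤ HR := by
      rw [hHR, Fin.sum_univ_three]; linarith [abs_nonneg (g 0 : ℝ)]
    have hHNR : 8 * HR ≤ (2 : ℝ) ^ N ! := by rw [hHRn]; exact_mod_cast hHN
    have herr : ∀ {e f₁ f₂ : ℕ}, e + N ! ≤ f₁ → e + N ! ≤ f₂ →
        |(g 1 : ℝ)| * (2 / 2 ^ f₁) + |(g 2 : ℝ)| * (2 / (2 : ℝ) ^ f₂) ≤ 1 / (2 : ℝ) ^ e / 2 := by
      intro e f₁ f₂ hf₁ hf₂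
      have b1 : (2 : ℝ) / 2 ^ f₁ ≤ 2 / 2 ^ (e + N !) :=
        div_le_div_of_nonneg_left (by norm_num) (by positivity) (pow_le_pow_right₀ (by norm_num) hf₁)
      have b2 : (2 : ℝ) / 2 ^ f₂ ≤ 2 / 2 ^ (e + N !) :=
        div_le_div_of_nonneg_left (by norm_num) (by positivity) (pow_le_pow_right₀ (by norm_num) hf₂)
      have hpe : (0 : ℝ) < 2 ^ e := by positivity
      have key : HR * (2 / (2 : ℝ) ^ (e + N !)) ≤ 1 / (2 : ℝ) ^ e / 2 := by
        rw [pow_add, div_div, mul_div_assoc', div_le_div_iff₀ (by positivity) (by positivity), one_mul]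
        have := mul_le_mul_of_nonneg_left hHNR hpe.le
        nlinarith
      calc |(g 1 : ℝ)| * (2 / 2 ^ f₁) + |(g 2 : ℝ)| * (2 / (2 : ℝ) ^ f₂)
          ≤ |(g 1 : ℝ)| * (2 / 2 ^ (e + N !)) + |(g 2 : ℝ)| * (2 / 2 ^ (e + N !)) := by
            gcongr
        _ = (|(g 1 : ℝ)| + |(g 2 : ℝ)|) * (2 / 2 ^ (e + N !)) := by ring
        _ ≤ HR * (2 / 2 ^ (e + N !)) := by gcongr
        _ ≤ 1 / (2 : ℝ) ^ e / 2 := key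
    -- finishing move at a non-vanishing cut of resolution `2^{−e}`, `e ≤ c_{N+1}`
    set frm : ℝ := (g 0 : ℝ) + g 1 * liouvilleNumber 2 + g 2 * rhoW with hfrm
    have finish : ∀ {e : ℕ} {Φ : ℝ}, e ≤ cW (N + 1) → 1 / (2 : ℝ) ^ e ≤ |Φ| → |frm - Φ| ≤ 1 / (2 : ℝ) ^ e / 2 →
        Real.exp (-((1 + HR) ^ 17)) ≤ |frm| := by
      intro e Φ he hlow happ
      have h1 : |Φ| - |frm - Φ| ≤ |frm| := by
        have := abs_sub_abs_le_abs_sub Φ frm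
        rw [abs_sub_comm Φ frm] at this
        linarith
      have h2 : 1 / (2 : ℝ) ^ cW (N + 1) ≤ 1 / (2 : ℝ) ^ e :=
        one_div_le_one_div_of_le (by positivity) (pow_le_pow_right₀ (by norm_num) he)
      linarith [hgoal]
    -- bookkeeping inequalities between the exponents
    have i1 : N ! ≤ cW N := le_trans (Nat.le_mul_of_pos_left _ two_pos) (two_mul_factorial_le_cW N)
    have i2 : cW N + N ! ≤ (N + 1)! := cW_add_factorial_le hN3
    have i3 : (N + 1)! + N ! ≤ cW (N + 1) := factorial_add_le_cW_succ N
    have i4 : cW (N + 1) + (N + 1)! ≤ (N + 1 + 1)! := cW_add_factorial_le (by omega)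
    have i5 : (N + 1 + 1) * cW (N + 1) ≤ cW (N + 1 + 1) := succ_mul_cW_le (N + 1)
    have i6 : N ! ≤ (N + 1)! := Nat.factorial_le (Nat.le_succ N)
    have hcNN1 : cW N ≤ cW (N + 1) := (cW_lt_succ N).le
    by_cases hΦ1 : (g 0 : ℝ) + g 1 * partialSum 2 N + g 2 * tW N ≠ 0
    · -- cut `(N, N)`, resolution `2^{−c_N}`
      refine finish hcNN1 (formG_scale_lower g i1 le_rfl hΦ1) ((formG_approx g N N).trans ?_)
      exact herr i2 (by omega)
    by_cases hΦ2 : (g 0 : ℝ) + g 1 * partialSum 2 (N + 1) + g 2 * tW N ≠ 0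
    · -- cut `(N+1, N)`, resolution `2^{−(N+1)!}`
      refine finish (by omega) (formG_scale_lower g le_rfl (by omega) hΦ2) ((formG_approx g (N + 1) N).trans ?_)
      exact herr (by nlinarith [Nat.factorial_succ (N + 1)]) i3
    by_cases hΦ3 : (g 0 : ℝ) + g 1 * partialSum 2 (N + 1) + g 2 * tW (N + 1) ≠ 0
    · -- cut `(N+1, N+1)`, resolution `2^{−c_{N+1}}`
      refine finish le_rfl (formG_scale_lower g (by omega) le_rfl hΦ3) ((formG_approx g (N + 1) (N + 1)).trans ?_)
      have := two_le_cW (N + 1)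
      exact herr (by omega) (by nlinarith)
    · exact absurd (formG_three_scale g N (not_not.mp hΦ1) (not_not.mp hΦ2) (not_not.mp hΦ3)) h12

/-- An integer form in `z_G'` is the real number `g₀ + g₁ ℓ₂ + g₂ ρ_W`. -/
theorem zG3_form (g : Fin 3 → ℤ) :
    ∑ i, (g i : ℂ) * zG3 i = (((g 0 : ℝ) + g 1 * liouvilleNumber 2 + g 2 * rhoW : ℝ) : ℂ) := by
  rw [Fin.sum_univ_three]
  simp only [zG3, Matrix.cons_val_zero, Matrix.cons_val_one, Matrix.cons_val_two, Matrix.head_cons,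
    Matrix.tail_cons]
  push_cast; ring

/-- `∑ i, (g i : ℂ) * zG3pi i = (Real.pi : ℂ) * (((g 0 : ℝ) + g 1 * liouvilleNumber 2 + g 2 * rhoW : ℝ) : ℂ)`. -/
theorem zG3pi_form (g : Fin 3 → ℤ) :
    ∑ i, (g i : ℂ) * zG3pi i =
      (Real.pi : ℂ) * (((g 0 : ℝ) + g 1 * liouvilleNumber 2 + g 2 * rhoW : ℝ) : ℂ) := by
  rw [Fin.sum_univ_three]
  simp only [zG3pi, Matrix.cons_val_zero, Matrix.cons_val_one, Matrix.cons_val_two, Matrix.head_cons,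
    Matrix.tail_cons]
  push_cast; ring

/-- `‖∑ i, (g i : ℂ) * zG3 i‖ = |(g 0 : ℝ) + g 1 * liouvilleNumber 2 + g 2 * rhoW|`. -/
theorem norm_zG3_form (g : Fin 3 → ℤ) :
    ‖∑ i, (g i : ℂ) * zG3 i‖ = |(g 0 : ℝ) + g 1 * liouvilleNumber 2 + g 2 * rhoW| := by
  rw [zG3_form, Complex.norm_real, Real.norm_eq_abs]

/-- `‖∑ i, (g i : ℂ) * zG3pi i‖ = Real.pi * |(g 0 : ℝ) + g 1 * liouvilleNumber 2 + g 2 * rhoW|`. -/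
theorem norm_zG3pi_form (g : Fin 3 → ℤ) :
    ‖∑ i, (g i : ℂ) * zG3pi i‖ = Real.pi * |(g 0 : ℝ) + g 1 * liouvilleNumber 2 + g 2 * rhoW| := by
  rw [zG3pi_form, norm_mul, Complex.norm_real, Complex.norm_real, Real.norm_eq_abs, Real.norm_eq_abs,
    abs_of_pos Real.pi_pos]

/-- **(iii) `z_G'` has NO hyper-small integer forms** (the three-scale bound; hypothesis-free). -/
theorem not_hyperLinLiouville_zG3 : ¬ HyperLinLiouville zG3 := by
  intro hH
  obtain ⟨g, hg, hlt⟩ := hH 18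
  rw [norm_zG3_form] at hlt
  have hlow := form_lower_bound_G g hg
  have hX : (1 : ℝ) ≤ 1 + ∑ i, (|g i| : ℝ) := by
    have : (0 : ℝ) ≤ ∑ i, (|g i| : ℝ) :=
      Finset.sum_nonneg fun i _ => by exact_mod_cast abs_nonneg (g i)
    linarith
  have hmono : (1 + ∑ i, (|g i| : ℝ)) ^ 17 ≤ (1 + ∑ i, (|g i| : ℝ)) ^ 18 :=
    pow_le_pow_right₀ hX (by norm_num)
  have := Real.exp_le_exp.mpr (neg_le_neg hmono)
  linarith

/-- **(iii^π) `z_G'^π` has NO hyper-small integer forms** (hypothesis-free). -/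
theorem not_hyperLinLiouville_zG3pi : ¬ HyperLinLiouville zG3pi := by
  intro hH
  obtain ⟨g, hg, hlt⟩ := hH 18
  rw [norm_zG3pi_form] at hlt
  have hlow := form_lower_bound_G g hg
  have hX : (1 : ℝ) ≤ 1 + ∑ i, (|g i| : ℝ) := by
    have : (0 : ℝ) ≤ ∑ i, (|g i| : ℝ) :=
      Finset.sum_nonneg fun i _ => by exact_mod_cast abs_nonneg (g i)
    linarith
  have hmono : (1 + ∑ i, (|g i| : ℝ)) ^ 17 ≤ (1 + ∑ i, (|g i| : ℝ)) ^ 18 :=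
    pow_le_pow_right₀ hX (by norm_num)
  have := Real.exp_le_exp.mpr (neg_le_neg hmono)
  have hπ : (1 : ℝ) ≤ Real.pi := by have := Real.pi_gt_three; linarith
  have habs := abs_nonneg ((g 0 : ℝ) + g 1 * liouvilleNumber 2 + g 2 * rhoW)
  nlinarith

/-- **`z_G'` lies in the scope of item 33364** — all three hypotheses, HYPOTHESIS-FREE (text of the binders). -/
theorem zG3_in_scope_33364 :
    LinearIndependent ℚ zG3 ∧
    (∀ ω : ℕ, ∃ h : Fin 3 → ℤ, h ≠ 0 ∧ ‖∑ i, (h i : ℂ) * zG3 i‖ < 1 / (1 + ∑ i, (|h i| : ℝ)) ^ ω) ∧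
    (¬ ∀ m : ℕ, ∃ h : Fin 3 → ℤ, h ≠ 0 ∧
      ‖∑ i, (h i : ℂ) * zG3 i‖ < Real.exp (-((1 + ∑ i, (|h i| : ℝ)) ^ m))) :=
  ⟨linearIndependent_zG3, linLiouville_zG3, not_hyperLinLiouville_zG3⟩

/-- `LinearIndependent ℚ zG3pi ∧ (∀ ω : ℕ, ∃ h : Fin 3 → ℤ, h ≠ 0 ∧ ‖∑ i, (h i : ℂ) * zG3pi i‖ < 1 / (1 + ∑ i, (|h i| : ℝ)) ^ ω) ∧ (¬ ∀ m : ℕ, ∃ h : Fin 3 → ℤ, h ≠ 0 ∧ ‖∑ i, (h i : ℂ) * zG3pi i‖ < Real.exp (-((1 + ∑ i, (|h i|`. -/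
theorem zG3pi_in_scope_33364 :
    LinearIndependent ℚ zG3pi ∧
    (∀ ω : ℕ, ∃ h : Fin 3 → ℤ, h ≠ 0 ∧ ‖∑ i, (h i : ℂ) * zG3pi i‖ < 1 / (1 + ∑ i, (|h i| : ℝ)) ^ ω) ∧
    (¬ ∀ m : ℕ, ∃ h : Fin 3 → ℤ, h ≠ 0 ∧
      ‖∑ i, (h i : ℂ) * zG3pi i‖ < Real.exp (-((1 + ∑ i, (|h i| : ℝ)) ^ m))) :=
  ⟨linearIndependent_zG3pi, linLiouville_zG3pi, not_hyperLinLiouville_zG3pi⟩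

/-- **ITEM 33364 DECIDED AT `z_G'`** (mod `hNW`): scope (i)–(iii) hypothesis-free AND the conclusion. -/
theorem finiteOrderLiouvilleSchanuel_at_zG3 (hNW : NWMeasure) :
    LinearIndependent ℚ zG3 ∧ LinLiouville zG3 ∧ ¬ HyperLinLiouville zG3 ∧ SB 3 zG3 :=
  ⟨linearIndependent_zG3, linLiouville_zG3, not_hyperLinLiouville_zG3, sb_zG3 hNW⟩

/-- **ITEM 33364 DECIDED AT `z_G'^π` — HYPOTHESIS-FREE.** -/
theorem finiteOrderLiouvilleSchanuel_at_zG3pi :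
    LinearIndependent ℚ zG3pi ∧ LinLiouville zG3pi ∧ ¬ HyperLinLiouville zG3pi ∧ SB 3 zG3pi :=
  ⟨linearIndependent_zG3pi, linLiouville_zG3pi, not_hyperLinLiouville_zG3pi, sb_zG3pi⟩

/-- **THE LIVE ITEM 33364 APPLIED at `z_G'`** (its text as a hypothesis; the member discharges all binders). -/
theorem item33364_at_zG3
    (h33364 : ∀ (n : ℕ) (z : Fin n → ℂ), LinearIndependent ℚ z →
      (∀ ω : ℕ, ∃ h : Fin n → ℤ, h ≠ 0 ∧ ‖∑ i, (h i : ℂ) * z i‖ < 1 / (1 + ∑ i, (|h i| : ℝ)) ^ ω) →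
      (¬ ∀ m : ℕ, ∃ h : Fin n → ℤ, h ≠ 0 ∧
        ‖∑ i, (h i : ℂ) * z i‖ < Real.exp (-((1 + ∑ i, (|h i| : ℝ)) ^ m))) →
      (n : Cardinal) ≤ Algebra.trdeg ℚ
        ↥(IntermediateField.adjoin ℚ (Set.range z ∪ Set.range (Complex.exp ∘ z)))) :
    SB 3 zG3 := h33364 3 zG3 linearIndependent_zG3 linLiouville_zG3 not_hyperLinLiouville_zG3

/-- **`ρ_W` is BELOW every previously decided Liouville class of the route** (hypothesis-free): not log-log
(§7), hence — by the tree ladder lemmas — not log-square (lens 6), not log-hyper (g34), not hyper-Liouville (the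
route's class); and `ρ_W` IS Liouville.  So `z_G'`, `z_G` are NEW points: in no LogLog / TwoBase / CommonRadix /
RelLiouville / MeasuredWall cell (their third coordinates are `ℓ₃`, `ℓ₄`, `ℓ_T`, log-log reals, or need `ρ` in a
class above the floor). -/
theorem rhoW_below_previous_classes :
    Liouville rhoW ∧ ¬ LogLogLiouville rhoW ∧
    ¬ Summit.Schanuel.Schanuel.Theorems.RootDecomp1KGeneric.LogSqLiouville rhoW ∧
    ¬ Summit.Schanuel.Schanuel.Theorems.RootDecomp1KRelLiouvilleCell.LogHyperLiouville rhoW ∧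
    ¬ Summit.Schanuel.Schanuel.Theorems.RootDecomp1KHyper.HyperCell.HyperLiouville rhoW :=
  ⟨liouville_rhoW, not_logLogLiouville_rhoW, fun h => not_logLogLiouville_rhoW (logLogLiouville_of_logSqLiouville h),
    fun h => not_logLogLiouville_rhoW (logLogLiouville_of_logHyperLiouville h),
    fun h => not_logLogLiouville_rhoW (logLogLiouville_of_hyperLiouville h)⟩

end ThreeScales

end Summit.Schanuel.Schanuel.Theorems.RootDecomp1KGapCell
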